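import Literature.NumberTheory.EllipticCurves.KuriharaNumberDeepInvariants
import Summits.BirchSwinnertonDyer.Rank1Residual.Additive.N11KimAtThreePUB
import HarnessLib

/-!
# N11 — Kim-at-3, analytic rank 0, EVERY local torsion `t = v₃ #E(ℚ₃)[3^∞]`: the DEEP-LIMIT form of
# the kim3 CELL THEOREM (memo `kim3/KIM3-PROOF.md` v2.2 §14, Theorem A-t) as a NAME

HONEST FRAMING. Cell `bsd-addord` (run/shared/lean/pub/bsd-addord/). This file NAMES the statement of
Theorem A-t (ii) of `kim3/KIM3-PROOF.md` v2.2 (§14): for `W/ℚ` with the `3`-adic tower onto and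
`L(E,1) ≠ 0`, `Ш(E/ℚ)[3^∞]` is finite and `length Ш[3^∞] = ord₃(L(E,1)/Ω⁺_f) − ∂^{(∞)}_{deep}(δ̃)`
with the DEEP-LIMIT invariant `kuriharaPartialDeepInfty` (Mazur–Rubin Def. 4.5.7 / Thm. 5.2.12 (i)
shape; `Literature/…/KuriharaNumberDeepInvariants.lean`) — NO hypothesis on `E(ℚ₃)[3]`. Compared with
`KimAtThreeRankZeroPUB` (`N11KimAtThreePUB.lean`: binder `#E(ℚ₃)[3] = 1`, ALL-LEVELS invariant
`kuriharaPartialInfty`) neither name implies the other formally: the all-levels infimum is `≤` the deep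
limit (`kuriharaPartialInfty_le_kuriharaPartialDeepInfty`) and they coincide exactly when the memo's
normalisation exponent `e_t(Ω⁺_f) = v₃(c₃) + v₃(c₀) + b − t` is `≥ 0` (memo §4.4(c), §14.6).
NOTHING is asserted by the `def`; every theorem below takes the name as an explicit hypothesis. Text of
record / referee verdict: see the docstring of the `def`. NOT a Literature fact; the announced record
`Kim2025.thm11_kimShaLength_of_integralPeriod_OPEN` and its flag are untouched.

## Contents
* `KimAtThreeDeepPUB` — the name.
* `padicValNat_sha_add_partialInfty_le_of_kimAtThreeDeepPUB` — granted the name, on every tower row with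
  `L(E,1) ≠ 0`: `ord₃ #Ш(E/ℚ)(3) + ∂^{(∞)}(δ̃) ≤ ∂^{(0)}(δ̃) = ord₃(L(E,1)/Ω⁺_f)` (all-levels `∂^{(∞)}`),
  i.e. ONE unit Kurihara number at ANY cyclic level gives the `t`-free UPPER bound
  `ord₃ #Ш ≤ ord₃(L(E,1)/Ω⁺_f)`; `sha_le_partial_zero_of_kimAtThreeDeepPUB_of_kuriharaUnitAt` spells it.
* `sha_le_three_of_kimAtThreeDeepPUB_of_kuriharaUnitAt`, `missingUpperBoundAt_three_of_kimAtThreeDeepPUB_of_kuriharaUnitAt`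
  — the same in BSD currency for a datum `D` with the period transfer `hper` (C10-R's (P) clause displayed):
  `ord₃ #Ш ≤ ord₃ #Ш_an + ord₃ ∏ c_ℓ`, and `MissingUpperBoundAt W 3` when `3 ∤ ∏ c_ℓ` (every `t`).

References: [MazurRubin2004] Def. 4.5.7, Def. 5.2.11, Thm. 5.2.12, Prop. A.2; [Kim2025RefinedTNC]
Thm. 1.1; [Kato2004Asterisque]; [Sakamoto2024]; memo `run/shared/lean/pub/bsd-addord/kim3/KIM3-PROOF.md`
v2.2 §14 (planner ruling TARGET.md v2.1 / L4.17).
-/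

noncomputable section

open scoped MatrixGroups ModularForm Classical

open CongruenceSubgroup WeierstrassCurve Literature.NumberTheory.EllipticCurves
  Literature.NumberTheory.EllipticCurves.ModularForms
  Literature.NumberTheory.EllipticCurves.Kim2025
  Literature.NumberTheory.EllipticCurves.Rank1Residual
  Literature.NumberTheory.EllipticCurves.Rank1Residual.Typed

namespace Summit.BirchSwinnertonDyer.Rank1Residual.Additive.N11

open Summit.BirchSwinnertonDyer.Rank1Residual.X4

/-- **Kim-at-3, rank 0, DEEP form (every `t`) — CELL THEOREM of `bsd-addord` seat kim3** (memo
`kim3/KIM3-PROOF.md` v2.2, §14 Theorem A-t; text of record sha256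
`fa22ee64825b0d315b5c1a9621a1a7148a2a92d289c2febe1c7c7177552c66c6`; REFEREE VERDICT `REF … SCORE
KIM3-PROOF v2.2: C15 PASS` (§14), cell bus `run/shared/lean/pub/bsd-addord/STATUS.md` 2026-08-25T11:02Z, report
`run/shared/lean/pub/bsd-addord/REF-kim3.md` part «REF-kim3-v2» §(iv); also C13/C14/C16 PASS, C10-R's derivation
branch lifted; the (P) period-transfer clause remains for BSD-currency consumers, of which this file has none),
proved from PUBLISHED inputs [Ka04 (incl. the N-depleted integral Euler system (8.1.3)/13.3,
enough for this clause); MR04 (H.4)-free items + Prop. A.2 (general clause, explicit depth `k + t`) +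
Thm. A.4; S24 4.4/5.5/6.7; BK90] + memo lemmas L/L′_t/D_t; NOT a Literature fact. For `W/ℚ` globally
minimal with newform `f`, the `3`-adic tower onto, `Ш(E/ℚ)` finite, `Ω⁺_f` an integral period of the
plus symbols and `ord(δ̃) = 0`: the DEEP-LIMIT `∂^{(∞)}_{deep}(δ̃)` is a natural number `d` and
`∂^{(0)}(δ̃) = ord₃ #Ш(E/ℚ)(3) + d`. No binder on `E(ℚ₃)[3]`. A `Prop`; nothing is asserted by the
`def`. [cite: Kim2025RefinedTNC, Thm. 1.1 ("BSD") (PDF p. 5)] [cite: MazurRubin2004, Thm. 5.2.12 (i) and Prop. A.2]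
KERNEL STATUS: an OPEN obligation node (`@[conjecture]`). -/
@[conjecture] def KimAtThreeDeepPUB : Prop :=
  ∀ (W : WeierstrassCurve ℚ) [W.IsElliptic] [W.IsGloballyMinimal],
    (∀ n : ℕ, W.HasSurjectiveModNGaloisRep (3 ^ n : ℕ)) →
    Finite W.sha →
    ∀ {N : ℕ} [NeZero N] (f : CuspForm (Gamma0 N) 2), IsNewformOf W f →
    (∀ r : ℚ, ratPlusSymbol f r ≠ 0 → 0 ≤ padicValRat 3 (ratPlusSymbol f r)) →
    kuriharaVanishingOrder W 3 f = 0 →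
      ∃ d : ℕ, kuriharaPartialDeepInfty W 3 f = d ∧
        kuriharaPartial W 3 f 0 =
          ((padicValNat 3 (Nat.card (AddCommGroup.primaryComponent W.sha 3)) + d : ℕ) : ℕ∞)

section Consumers

variable (W : WeierstrassCurve ℚ) [W.IsElliptic] [W.IsGloballyMinimal]

/-- **Granted the name, the all-levels `∂^{(∞)}` gives a `t`-free UPPER bound**: on every tower row
with `Ш` finite, integral plus symbols and `ord(δ̃) = 0`,
`ord₃ #Ш(E/ℚ)(3) + ∂^{(∞)}(δ̃) ≤ ∂^{(0)}(δ̃)` — because the all-levels infimum is `≤` the deep limit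
(`kuriharaPartialInfty_le_kuriharaPartialDeepInfty`). [cite: MazurRubin2004, Def. 5.2.11 and Thm. 5.2.12 (i)]
[cite: Kim2022StructureSelmer, §1.5.1 (PDF p. 7)] -/
theorem padicValNat_sha_add_partialInfty_le_of_kimAtThreeDeepPUB (hK : KimAtThreeDeepPUB)
    (htower : ∀ n : ℕ, W.HasSurjectiveModNGaloisRep (3 ^ n : ℕ)) (hfin : Finite W.sha)
    {N : ℕ} [NeZero N] (f : CuspForm (Gamma0 N) 2) (hf : IsNewformOf W f)
    (hint : ∀ r : ℚ, ratPlusSymbol f r ≠ 0 → 0 ≤ padicValRat 3 (ratPlusSymbol f r))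
    (hord : kuriharaVanishingOrder W 3 f = 0) :
    (padicValNat 3 (Nat.card (AddCommGroup.primaryComponent W.sha 3)) : ℕ∞) +
        kuriharaPartialInfty W 3 f ≤ kuriharaPartial W 3 f 0 := by
  obtain ⟨d, hd, h0⟩ := hK W htower hfin f hf hint hord
  have hle : kuriharaPartialInfty W 3 f ≤ (d : ℕ∞) := by
    rw [← hd]; exact kuriharaPartialInfty_le_kuriharaPartialDeepInfty W 3 f
  rw [h0, Nat.cast_add]
  exact add_le_add le_rfl hle

/-- **One unit Kurihara number at ANY cyclic level ⇒ `ord₃ #Ш(E/ℚ)(3) ≤ ∂^{(0)}(δ̃) = ord₃(L(E,1)/Ω⁺_f)`**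
(granted the name; every `t`): a unit makes the all-levels `∂^{(∞)}` vanish
(`kuriharaPartialInfty_eq_zero_of_ne_zero`). The `t`-free UPPER half; the LOWER half at `t > 0` needs
a unit at a level of depth `2 + t` (memo §16 Cor C-t), not typed here.
[cite: Kim2022StructureSelmer, Thm. 1.9 (1) (PDF p. 7)] [cite: MazurRubin2004, Thm. 5.2.12] -/
theorem sha_le_partial_zero_of_kimAtThreeDeepPUB_of_kuriharaUnitAt (hK : KimAtThreeDeepPUB)
    (htower : ∀ n : ℕ, W.HasSurjectiveModNGaloisRep (3 ^ n : ℕ)) (hfin : Finite W.sha)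
    {N : ℕ} [NeZero N] (f : CuspForm (Gamma0 N) 2) (hf : IsNewformOf W f)
    (hint : ∀ r : ℚ, ratPlusSymbol f r ≠ 0 → 0 ≤ padicValRat 3 (ratPlusSymbol f r))
    (hord : kuriharaVanishingOrder W 3 f = 0) (hKu : KuriharaUnitAt W 3 f) :
    (padicValNat 3 (Nat.card (AddCommGroup.primaryComponent W.sha 3)) : ℕ∞) ≤
      kuriharaPartial W 3 f 0 := by
  have h := padicValNat_sha_add_partialInfty_le_of_kimAtThreeDeepPUB W hK htower hfin f hf hint hord
  obtain ⟨n, hn0, hn, hcyc, ψ, hψ, hδ⟩ := hKu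
  haveI := hn0
  rw [kuriharaPartialInfty_eq_zero_of_ne_zero W 3 f ⟨hn, hcyc⟩ ψ hψ hδ, add_zero] at h
  exact h

/-! ### BSD-currency form of the `t`-free UPPER half (one unit Kurihara number at ANY cyclic level) -/

/-- **Granted the name: ONE unit Kurihara number at ANY cyclic Kolyvagin level gives the census-currency
UPPER inequality `ord₃ #Ш(E/ℚ) ≤ ord₃ #Ш_an + ord₃ ∏_ℓ c_ℓ(E)`** on a tower row with `L(E,1) ≠ 0` and a
parametrisation datum `D` with the period transfer `Ω(W) = u·Ω⁺_{D.f}`, `|u|₃ = 1` — EVERY local torsion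
`t` (no `E(ℚ₃)[3]` binder), no Manin-constant and no Tamagawa hypothesis. Chain: the unit kills the
all-levels `∂^{(∞)}` (`sha_le_partial_zero_of_kimAtThreeDeepPUB_of_kuriharaUnitAt`), `∂^{(0)}(δ̃) =
ord₃ [0]⁺_{D.f}` (`kuriharaDivIndex_one_eq`; the `3`-integrality of the plus symbols is the tree theorem
`forall_padicValRat_ratPlusSymbol_nonneg_of_towerSurj`), `L(E,1)/Ω(W) = [0]⁺_{D.f}/u` with `ord₃ u = 0`,
and `#Ш_an = (L/Ω)·#tors²/∏c` with `3 ∤ #tors` (`E[3]` irreducible under the tower); GZK `hGZK` for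
`rank = r_an` and the finiteness of `Ш`. The `t`-free twin of `sha_le_three_of_kimAtThreeRankZeroPUB`
(which needs no unit but the binder `t = 0`). [cite: Kim2025RefinedTNC, Thm. 1.1 ("BSD") (PDF p. 5)]
[cite: Kim2022StructureSelmer, Thm. 1.9 (1) and (6) (PDF pp. 7–8)] [cite: Miller2011LMS, Def. 1.1] -/
theorem sha_le_three_of_kimAtThreeDeepPUB_of_kuriharaUnitAt (hK : KimAtThreeDeepPUB)
    (hGZK : rank_eq_analyticRank_of_analyticRank_le_one)
    (htower : ∀ n : ℕ, W.HasSurjectiveModNGaloisRep (3 ^ n : ℕ)) (hL : W.entireLFunction 1 ≠ 0)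
    {N : ℕ} [NeZero N] (D : ModularParametrizationData W N)
    (hper : ∃ u : ℚ, ‖(u : ℚ_[3])‖ = 1 ∧ W.realPeriodRat = u * plusPeriod D.f)
    (hKu : KuriharaUnitAt W 3 D.f) :
    ∃ q' : ℚ, shaAn W = (q' : ℂ) ∧
      (padicValNat 3 W.shaOrder : ℤ) ≤ padicValRat 3 q' + padicValNat 3 W.tamagawaProduct := by
  haveI : Fact (Nat.Prime 3) := ⟨Nat.prime_three⟩
  have h32 : (3 : ℕ) ≠ 2 := by norm_num
  have hr0 : W.analyticRank = 0 := analyticRank_eq_zero_of_entireLFunction_one_ne_zero hL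
  obtain ⟨hmw, hfin⟩ := hGZK W (by rw [hr0]; exact zero_le_one)
  haveI : Finite W.sha := hfin
  have hirr : W.HasIrreducibleModPGaloisRep 3 :=
    hasIrreducibleModPGaloisRep_of_hasSurjectiveModNGaloisRep W 3 (by simpa using htower 1)
  -- `ord₃ #Ш(3) ≤ ∂^{(0)}(δ̃) = ord₃ [0]⁺_{D.f}`
  have hint := forall_padicValRat_ratPlusSymbol_nonneg_of_towerSurj h32 D.isNewformOf htower
  have hint0 : ¬ 3 ∣ (ratPlusSymbol D.f 0).den :=
    not_dvd_den_of_norm_ratCast_le_one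
      (D.isNewformOf.norm_ratPlusSymbol_le_one (x := 0) h32 hirr (by simp))
  have hLeq := D.isNewformOf.entireLFunction_one_eq
  have hne : ratPlusSymbol D.f 0 ≠ 0 := by
    intro h0
    apply hL
    rw [hLeq, h0]
    simp
  have hord : kuriharaVanishingOrder W 3 D.f = 0 :=
    kuriharaVanishingOrder_eq_zero_of_ratPlusSymbol_ne_zero W 3 D.f hint0 hne
  have hup0 := sha_le_partial_zero_of_kimAtThreeDeepPUB_of_kuriharaUnitAt W hK htower hfin D.f
    D.isNewformOf hint hord hKu
  rw [kuriharaPartial_zero, kuriharaDivIndex_one_eq W 3 D.f hint0 hne] at hup0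
  have hnat : padicValNat 3 (Nat.card (AddCommGroup.primaryComponent W.sha 3)) ≤
      (padicValRat 3 (ratPlusSymbol D.f 0)).toNat := by exact_mod_cast hup0
  have hv0 : 0 ≤ padicValRat 3 (ratPlusSymbol D.f 0) := by
    unfold padicValRat
    rw [padicValNat.eq_zero_of_not_dvd hint0]
    simp
  have hval : (padicValNat 3 (Nat.card (AddCommGroup.primaryComponent W.sha 3)) : ℤ) ≤
      padicValRat 3 (ratPlusSymbol D.f 0) := by
    have := Int.toNat_of_nonneg hv0
    rw [← this]
    exact_mod_cast hnat
  -- the period transfer: `L(E,1)/Ω(W) = [0]⁺/u`, `ord₃ u = 0`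
  obtain ⟨u, hu, hΩ⟩ := hper
  have hu0 : u ≠ 0 := by
    rintro rfl
    rw [Rat.cast_zero, norm_zero] at hu
    exact zero_ne_one hu
  have hΩf : 0 < plusPeriod D.f :=
    IsNewform0.plusPeriod_pos_holds D.isNewformOf.1 D.isNewformOf.coeffField_eq_bot
  have hq₀ : W.entireLFunction 1 / (W.realPeriodRat : ℂ) = ((ratPlusSymbol D.f 0 / u : ℚ) : ℂ) := by
    rw [hLeq, hΩ]
    have hu' : (u : ℂ) ≠ 0 := by exact_mod_cast hu0
    have hΩf' : ((plusPeriod D.f : ℝ) : ℂ) ≠ 0 := by exact_mod_cast hΩf.ne'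
    push_cast
    field_simp
  have hq₀0 : ratPlusSymbol D.f 0 / u ≠ 0 := div_ne_zero hne hu0
  have hsha : padicValNat 3 (Nat.card (AddCommGroup.primaryComponent W.sha 3)) =
      padicValNat 3 W.shaOrder := by
    unfold WeierstrassCurve.shaOrder
    exact padicValNat_card_addPrimaryComponent 3
  have hvu : padicValRat 3 u = 0 := by
    have hu0' : (u : ℚ_[3]) ≠ 0 := by
      intro h
      rw [h, norm_zero] at hu
      exact zero_ne_one hu
    have hu1 := hu
    rw [Padic.norm_eq_zpow_neg_valuation hu0', Padic.valuation_ratCast] at hu1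
    have hp1 : (1 : ℝ) < ((3 : ℕ) : ℝ) := by norm_num
    have h := (zpow_eq_one_iff_right₀ (zero_le_one.trans hp1.le) hp1.ne').mp hu1
    linarith
  refine ⟨ratPlusSymbol D.f 0 / u * (W.torsionOrder : ℚ) ^ 2 / (W.tamagawaProduct : ℚ),
    shaAn_eq_of_rankZero_witness W hmw hL hq₀, ?_⟩
  rw [Supersingular.padicValRat_shaAn_witness W 3 hirr hq₀0, ← hsha, padicValRat.div hne hu0, hvu,
    sub_zero]
  linarith

/-- **Granted the name: ONE unit Kurihara number at ANY cyclic Kolyvagin level + `3 ∤ ∏_ℓ c_ℓ(E)` gives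
the UPPER half `MissingUpperBoundAt W 3`** (`ord₃ #Ш(E/ℚ) ≤ ord₃ #Ш_an`) on a tower row with
`L(E,1) ≠ 0` and a datum with the period transfer — every `t`. The LOWER half on such rows is the deep
(`KimAtThreeDeepCertPUB`, depth `2 + t`) or the 3-split (`KimAtThreeSplitCertPUB`, depth `2`) certificate
lane of `N11KimAtThreeDeepCertPUB.lean`, or `KimAtThreeRankZeroPUB` at `t = 0`.
[cite: Kim2025RefinedTNC, Thm. 1.1 ("BSD") (PDF p. 5)] [cite: Miller2011LMS, Def. 1.1] -/
theorem missingUpperBoundAt_three_of_kimAtThreeDeepPUB_of_kuriharaUnitAt (hK : KimAtThreeDeepPUB)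
    (hGZK : rank_eq_analyticRank_of_analyticRank_le_one)
    (htower : ∀ n : ℕ, W.HasSurjectiveModNGaloisRep (3 ^ n : ℕ)) (hL : W.entireLFunction 1 ≠ 0)
    {N : ℕ} [NeZero N] (D : ModularParametrizationData W N)
    (hper : ∃ u : ℚ, ‖(u : ℚ_[3])‖ = 1 ∧ W.realPeriodRat = u * plusPeriod D.f)
    (hKu : KuriharaUnitAt W 3 D.f) (htam : ¬ 3 ∣ W.tamagawaProduct) : MissingUpperBoundAt W 3 := by
  haveI : Fact (Nat.Prime 3) := ⟨Nat.prime_three⟩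
  obtain ⟨q', hq', hle⟩ :=
    sha_le_three_of_kimAtThreeDeepPUB_of_kuriharaUnitAt W hK hGZK htower hL D hper hKu
  refine ⟨q', hq', ?_⟩
  rw [padicValNat.eq_zero_of_not_dvd htam, Nat.cast_zero, add_zero] at hle
  exact hle

end Consumers

end Summit.BirchSwinnertonDyer.Rank1Residual.Additive.N11

end
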